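import Literature.Claims.NS.Fulber2026
import HarnessLib

/-!
# C148 `Fulber2026` — kernel companions to the refuter's verdict (ns-claims cell, memo D0090)

Typed skeleton of record: `Literature/Claims/NS/Fulber2026.lean` (typist-3 g5), composition
`Literature.Claims.NS.Fulber2026.claim_of_steps` in the printed order FIG. 2 p. 2:
`Chae2007.Step_1 → Step1_Thm32 → Step12_glue → Step2_L51 → Step3a → Step3b → Step3c_inference → Step3d →
Step3_inference → Step4 → Step5 → ClaimedTheorem`.

What this file proves (sorry-free, standard axioms), each a negation of a typed decl AS TYPED:

* `not_Step2_L51Abs_b` — Lemma 5.1 p. 3, second printed inequality «(1 − δ₀)⟨λ₁⟩ + δ₀⟨λ₂⟩ < (1 − δ₀/2)⟨λ₁⟩» at the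
  real-number grain (`Step2_L51Abs_b`, by-slot abstraction of the on-path `Step2_L51`): false at the admissible
  trace-free ordered triple `(λ₁, λ₂, λ₃) = (1, 1, −2)` with `δ₀ = 1/2` (left side `1`, right side `3/4`); the
  inequality is equivalent to `λ₂ < λ₁/2`, which «λ₁ ≥ λ₂ ≥ λ₃, λ₁ + λ₂ + λ₃ = 0» does not give.
* `not_Step3d_BoundedFromRiccati` — «The reduced coefficient (1 − δ₀/2)⁴ < 1 slows growth, and refined analysis
  yields bounded Ω_max» p. 3, typed at the real-function grain (`Step3d_BoundedFromRiccati`, ON PATH as the binder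
  `h3d` of `claim_of_steps`): false — `y(t) = (1 − t)⁻¹` on `[0,1)` has `y(0) = 1`, `y ≥ 0`, `y' = y²` (so
  `y' ≤ k y²` with `k = 1`), and exceeds every proposed bound `Ω_max` before `t = 1`. A Riccati inequality
  `Ω' ≤ kΩ²` bounds nothing globally; no «refined analysis» is printed.

These are recorded ALONGSIDE the verdict; the verdict's token (first failing step in the order of `claim_of_steps`)
is `Step1_Thm32` (Theorem 3.2 p. 2), for which no derivation is printed (§VII pp. 3–4 supplies Lamb–Oseen
scalings for undefined quantities `R_press`, `R_vort`, `𝒢`, `L/a`), class unfilled gap — see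
`claims/Fulber2026/REFUTER.md`.

WHAT THIS IS NOT: not a claim about NS regularity or blow-up; not a claim about any author beyond the typed locator.
-/

noncomputable section

open Set Filter Topology

set_option linter.dupNamespace false

namespace Summit.NavierStokesRegularity.NavierStokesRegularity.Theorems.Fulber2026

open Literature.Claims.NS.Fulber2026

/-! ### Lemma 5.1, second inequality (p. 3) at the real-number grain -/

/-- **Refutes `Literature.Claims.NS.Fulber2026.Step2_L51Abs_b` as typed** (Lemma 5.1 p. 3, «< (1 − δ₀/2)⟨λ₁⟩_Ω»,
real-number grain): at `δ₀ = 1/2` and the admissible triple `(1, 1, −2)` (ordered, trace-free, `λ₁ > 0`) the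
claimed strict inequality reads `1 < 3/4`. [cite: Fulber2026, Lemma 5.1 p.3] -/
theorem not_Step2_L51Abs_b : ¬ Step2_L51Abs_b := by
  intro h
  have := h (1 / 2) 1 1 (-2) (by norm_num) (by norm_num) (by norm_num) le_rfl (by norm_num) (by norm_num)
  norm_num at this

/-! ### «refined analysis yields bounded Ω_max» (p. 3) at the real-function grain -/

/-- **Refutes `Literature.Claims.NS.Fulber2026.Step3d_BoundedFromRiccati` as typed** («refined analysis yields
bounded Ω_max», §V Step 2→3 p. 3, real-function grain; ON PATH as `h3d` of `claim_of_steps`): with `k = 1`,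
`Ω₀ = 1`, horizon `T = 1`, `y(t) = (1 − t)⁻¹`, `D(t) = y(t)²`, all hypotheses hold on `[0,1)` and `y` exceeds any
`Ω_max`. [cite: Fulber2026, §V Step 2→3 p.3] -/
theorem not_Step3d_BoundedFromRiccati : ¬ Step3d_BoundedFromRiccati := by
  intro h
  -- the witness `y(t) = (1 - t)⁻¹`: `y' = y²` for `t < 1`
  have hderiv : ∀ t : ℝ, t < 1 → HasDerivAt (fun s : ℝ => (1 - s)⁻¹) (((1 - t)⁻¹) ^ 2) t := by
    intro t ht
    have h1 : HasDerivAt (fun s : ℝ => 1 - s) (-1) t := (hasDerivAt_id t).const_sub 1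
    have hne : (1 - t) ≠ 0 := by linarith
    refine (h1.inv hne).congr_deriv ?_
    rw [neg_neg, inv_pow, one_div]
  -- … and it leaves every bound before `t = 1`
  have hunb : ∀ M : ℝ, ∃ t ∈ Ico (0:ℝ) 1, M < (1 - t)⁻¹ := by
    intro M
    have hpos : 0 < |M| + 1 := by positivity
    have hq : 0 < 1 / (|M| + 1) := by positivity
    have hq1 : 1 / (|M| + 1) ≤ 1 := by
      rw [div_le_one hpos]; linarith [abs_nonneg M]
    refine ⟨1 - 1 / (|M| + 1), ⟨by linarith, by linarith⟩, ?_⟩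
    rw [show (1:ℝ) - (1 - 1 / (|M| + 1)) = 1 / (|M| + 1) by ring, one_div, inv_inv]
    linarith [le_abs_self M]
  obtain ⟨Ωmax, hΩ⟩ := h 1 1 one_pos zero_le_one
  have hb := hΩ 1 one_pos (fun t => (1 - t)⁻¹) (fun t => ((1 - t)⁻¹) ^ 2) (by norm_num)
    (fun t ht => inv_nonneg.mpr (by linarith [ht.2]))
    (fun t ht => ⟨(hderiv t ht.2).hasDerivWithinAt, by rw [one_mul]⟩)
  obtain ⟨t, ht, hlt⟩ := hunb Ωmax
  exact absurd (hb t ht) (not_le.mpr hlt)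

end Summit.NavierStokesRegularity.NavierStokesRegularity.Theorems.Fulber2026

end
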